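import Summits.CriticalPhenomena.PercolationContinuityZ3.Theorems.PercNearOneGluingNoHeavyLowerTailKNConj4AllWeights
import HarnessLib

/-!
# Kozma–Nitzan's Conjecture 4 in its printed `min` shape, every weight vector

Support file (`--supports stmt-CriticalPhenomena-4575`), cell perc-kn (req609-KN), file F10, lead `perc-kn-lead` (g0).  No definitions,
no named facts, no sorries; standard axioms.  Statement of record: `Cruxes/NoHeavyLowerTail/Lines/kn_genmin.lean`.

Kozma–Nitzan's Conjecture 4 (arXiv:2401.12397, p. 32) reads `E(f(0)·1{0 ↔ A}) ≥ min_{a∈A} E(f(a)·1{0 ↔ A})` for every monotone cluster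
property `f`.  The tree proves it at every weight vector in the `∃ a ∈ A` shape (`PreFKGSurplus.kn_conj4`); this file records the literal
`min` shape `min_{a∈A} E[F(C_a); o ↔ A] ≤ E[F(C_o); o ↔ A]` (`Finset.inf'` over the nonempty relay set).
[cite: KozmaNitzan2024, Conj. 4 (p. 32)]
-/

noncomputable section

namespace Summit.CriticalPhenomena.PercolationContinuityZ3.Theorems

open MeasureTheory Set
open Literature.Probability.LatticeModels (prodBernoulli)
open Literature.Probability.Percolation
open scoped Classical

namespace PreFKGSurplus

/-- **Kozma–Nitzan's Conjecture 4 in the printed `min` shape, every weight vector in `[0,1]^E`**: for `F` monotone on vertex sets,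
`A ≠ ∅` and any `o`, `min_{a∈A} E[F(C_a); o ↔ A] ≤ E[F(C_o); o ↔ A]`.  (`PreFKGSurplus.kn_conj4`.) [cite: KozmaNitzan2024, Conj. 4 (p. 32)] -/
theorem kn_conj4_min {n : ℕ} (w : Sym2 (Fin n) → unitInterval) (A : Finset (Fin n)) (hA : A.Nonempty) (o : Fin n)
    (F : Set (Fin n) → ℝ) (hF : ∀ S T : Set (Fin n), S ⊆ T → F S ≤ F T) :
    A.inf' hA (fun a => ∫ ω in ⋃ a' ∈ A, openConn o a', F (openCluster ω a) ∂(prodBernoulli w)) ≤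
      ∫ ω in ⋃ a' ∈ A, openConn o a', F (openCluster ω o) ∂(prodBernoulli w) := by
  obtain ⟨a, ha, h⟩ := kn_conj4 w A o F hF hA
  exact (Finset.inf'_le _ ha).trans h

end PreFKGSurplus

end Summit.CriticalPhenomena.PercolationContinuityZ3.Theorems

end
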